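import Mathlib.LinearAlgebra.Matrix.ToLin
import Mathlib.LinearAlgebra.Matrix.BilinearForm
import Mathlib.LinearAlgebra.Eigenspace.Basic
import Mathlib.LinearAlgebra.FiniteDimensional.Lemmas
import Mathlib.Analysis.Complex.Basic
import HarnessLib

/-!
# Crux `WeilTwelvefoldsSqrtMinus7` (stmt-HodgeConjecture-1261), line `amnesic-secant-sheaves-split-fourteenfolds` — lemmas for stub `stub_weilSignatureOfModel` (α₂, r6), part III: van Geemen's Hermitian form

Helper file of the stub `stub_weilSignatureOfModel` (signature `(n, n)` of the rational degree-one model of a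
polarized abelian variety of Weil type; B. van Geemen, LNM 1594 (1994), Lemma 5.2 (4)–(5)), the part that is
COMPLEX linear algebra on an abstract finite-dimensional `ℂ`-space `V` (in the stub: `V = H¹(A(ℂ); ℂ)`) with
coordinates `β : V ≃ ℂ^ι` (a rational basis), an endomorphism `T` (`= φ^*`) with rational matrix `M_A`, a
bilinear `Q` (the polarization pairing `h^{2n-1} ⌣ x ⌣ y`) with rational Gram matrix `G_A` times a class `ω`, and
a conjugate-linear involution `κ` (complex conjugation) acting coordinatewise. With `C = G_A M_A` (symmetric) the
scalar `βx ⬝ C \overline{βy}` is the `ω`-coefficient of `Q(x, φ^* ȳ)` — van Geemen's `H(x, y)` up to the factor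
`√-d` — and this file proves, from the Hodge–Riemann input "`i Q(x, x̄) ∈ ℝ_{>0} · ρ ω` on `H^{1,0} ∖ 0`":

* `weilSig_finrank_le_of_semilinear` — a subspace mapped by `κ` into another has at most its dimension;
* `weilSig_re_pos_sup` — `Re H` is definite on `X ⊕ Y` if it is on `X`, `κ Y ⊆ X` and `X ⊥ Y` (`H(y) = H(κ y)`);
* `weilSig_piece` / `weilSig_piece_finrank` — for an eigenvalue `μ` of `T` (`μ² = -7`, `μ̄ = -μ`, `μ i = m ∈ ℝ`):
  on `Z_μ = (V_μ ∩ H^{1,0}) ⊕ (V_{-μ} ∩ H^{0,1})` the form `Re H` has the sign of `m ρ` and `dim Z_μ ≥ 2n`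
  (van Geemen, proof of 5.2 (4): `Q(V_μ, V_μ) = 0` by Weil type, `H` definite on `V_±^{1,0}` by Hodge–Riemann,
  conjugation swaps the pieces);
* `weilSig_exists_Zp_Zn` — hence complex subspaces `Z₊`, `Z₋ ⊆ ℂ^ι` of dimension `≥ 2n` on which `Re H` is
  positive, resp. negative: the input of part I (`weilSig_exists_PN`).

Everything is proved; no definition and no named fact is introduced.
-/

noncomputable section

set_option linter.dupNamespace false

open scoped Matrix ComplexConjugate

namespace Summit.HodgeConjecture.HodgeConjecture.Theorems.WeilTwelvefoldsSqrtMinus7.AmnesicSecantSheaves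

variable {ι : Type*} [Fintype ι] {V W : Type*} [AddCommGroup V] [Module ℂ V] [AddCommGroup W] [Module ℂ W]

/-! ## Conjugate-linear maps: sums, dimensions -/

/-- A conjugate-linear map on finite combinations: `κ (Σ gᵢ xᵢ) = Σ ḡᵢ κ xᵢ`. [folklore] -/
theorem weilSig_semilinear_sum (κ : V → V) (hκa : ∀ x y, κ (x + y) = κ x + κ y)
    (hκs : ∀ (c : ℂ) (x : V), κ (c • x) = conj c • κ x) {α : Type*} (s : Finset α) (g : α → ℂ) (x : α → V) :
    κ (∑ i ∈ s, g i • x i) = ∑ i ∈ s, conj (g i) • κ (x i) := by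
  classical
  have hκ0 : κ 0 = 0 := by simpa using hκs 0 0
  induction s using Finset.induction_on with
  | empty => simp [hκ0]
  | insert a s ha ih => rw [Finset.sum_insert ha, Finset.sum_insert ha, hκa, hκs, ih]

/-- **A subspace mapped by a conjugate-linear involution into another has at most its dimension** (the
images of a basis stay independent: conjugate the relation). [folklore] -/
theorem weilSig_finrank_le_of_semilinear [Module.Finite ℂ V] (κ : V → V) (hκa : ∀ x y, κ (x + y) = κ x + κ y)
    (hκs : ∀ (c : ℂ) (x : V), κ (c • x) = conj c • κ x) (hκκ : ∀ x, κ (κ x) = x)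
    (S₁ S₂ : Submodule ℂ V) (h : ∀ x ∈ S₁, κ x ∈ S₂) : Module.finrank ℂ S₁ ≤ Module.finrank ℂ S₂ := by
  classical
  let bS := Module.finBasis ℂ S₁
  let f : Fin (Module.finrank ℂ S₁) → S₂ := fun i => ⟨κ (bS i), h _ (bS i).2⟩
  have hf : LinearIndependent ℂ f := by
    rw [Fintype.linearIndependent_iff]
    intro g hg i
    have h1 : ∑ i, g i • κ (bS i : V) = 0 := by
      have h0 := congrArg (S₂.subtype) hg
      rw [map_sum, map_zero] at h0
      simpa only [map_smul, Submodule.subtype_apply, f] using h0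
    have h2 : κ (∑ i, g i • κ (bS i : V)) = ∑ i, conj (g i) • (bS i : V) := by
      rw [weilSig_semilinear_sum κ hκa hκs]
      simp_rw [hκκ]
    rw [h1, show κ 0 = 0 by simpa using hκs 0 0] at h2
    have h3 : ∑ i, conj (g i) • bS i = 0 := by
      apply S₁.subtype_injective
      rw [map_sum, map_zero]
      simpa only [map_smul, Submodule.subtype_apply] using h2.symm
    have h4 := Fintype.linearIndependent_iff.1 bS.linearIndependent _ h3 i
    simpa using h4
  simpa using hf.fintype_card_le_finrank

/-! ## The Hermitian form on a sum of two orthogonal pieces -/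

/-- **Van Geemen's Hermitian form on a sum of two pieces** (LNM 1594, proof of Lemma 5.2 (4): `H` is
definite on `V₊^{1,0} ⊕ V₋^{0,1}`). Let `C` be a SYMMETRIC complex `ι × ι` matrix, `β : V ≃ ℂ^ι`
coordinates, `κ : V → V` with `β (κ v) = \overline{β v}`, and `H(v) = Re (βv ⬝ C \overline{βv})`. If `H > 0` on
`X ∖ 0`, `κ` maps `Y` into `X`, and `βx ⬝ C \overline{βy} = 0 = βy ⬝ C \overline{βx}` for `x ∈ X`, `y ∈ Y`, then
`H > 0` on `β(X ⊔ Y) ∖ 0`: `H(x + y) = H(x) + H(y)` and `H(y) = H(κ y)` by the symmetry of `C`.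
[cite: vanGeemen1994HodgeAV, proof of Lemma 5.2 (4)] -/
theorem weilSig_re_pos_sup (β : V ≃ₗ[ℂ] (ι → ℂ)) (κ : V → V) (hκ : ∀ v, β (κ v) = star (β v))
    (C : Matrix ι ι ℂ) (hC : C.transpose = C) (X Y : Submodule ℂ V)
    (hX : ∀ x ∈ X, x ≠ 0 → 0 < (β x ⬝ᵥ C.mulVec (star (β x))).re) (hYX : ∀ y ∈ Y, κ y ∈ X)
    (hXY : ∀ x ∈ X, ∀ y ∈ Y, β x ⬝ᵥ C.mulVec (star (β y)) = 0)
    (hYX' : ∀ x ∈ X, ∀ y ∈ Y, β y ⬝ᵥ C.mulVec (star (β x)) = 0) :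
    ∀ z ∈ (X ⊔ Y).map (β : V →ₗ[ℂ] (ι → ℂ)), z ≠ 0 → 0 < (z ⬝ᵥ C.mulVec (star z)).re := by
  intro z hz hz0
  obtain ⟨v, hv, rfl⟩ := Submodule.mem_map.1 hz
  obtain ⟨x, hx, y, hy, rfl⟩ := Submodule.mem_sup.1 hv
  rw [LinearEquiv.coe_coe] at hz0 ⊢
  have hsymm : ∀ a c : ι → ℂ, a ⬝ᵥ C *ᵥ c = c ⬝ᵥ C *ᵥ a := fun a c => by
    conv_lhs => rw [Matrix.dotProduct_mulVec, ← Matrix.mulVec_transpose, hC, dotProduct_comm]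
  have e : β (x + y) ⬝ᵥ C *ᵥ star (β (x + y)) =
      β x ⬝ᵥ C *ᵥ star (β x) + β y ⬝ᵥ C *ᵥ star (β y) := by
    rw [map_add, star_add, Matrix.mulVec_add, dotProduct_add, add_dotProduct, add_dotProduct, hXY x hx y hy,
      hYX' x hx y hy]
    ring
  have ey : β y ⬝ᵥ C *ᵥ star (β y) = β (κ y) ⬝ᵥ C *ᵥ star (β (κ y)) := by
    rw [hκ, star_star, hsymm]
  have hκ0 : ∀ w : V, κ w = 0 ↔ w = 0 := fun w => by
    constructor
    · intro h0
      have h1 : star (β w) = 0 := by rw [← hκ, h0, map_zero]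
      exact β.injective (by rw [map_zero]; exact star_eq_zero.1 h1)
    · intro h0
      apply β.injective
      rw [hκ, h0, map_zero, star_zero]
  have Hx : 0 ≤ (β x ⬝ᵥ C *ᵥ star (β x)).re ∧ (x ≠ 0 → 0 < (β x ⬝ᵥ C *ᵥ star (β x)).re) := by
    by_cases hx0 : x = 0
    · subst hx0
      simp
    · exact ⟨(hX x hx hx0).le, fun _ => hX x hx hx0⟩
  have Hy : 0 ≤ (β y ⬝ᵥ C *ᵥ star (β y)).re ∧ (y ≠ 0 → 0 < (β y ⬝ᵥ C *ᵥ star (β y)).re) := by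
    rw [ey]
    by_cases hy0 : y = 0
    · subst hy0
      rw [(hκ0 0).2 rfl]
      simp
    · have hκy : κ y ≠ 0 := fun h0 => hy0 ((hκ0 y).1 h0)
      exact ⟨(hX _ (hYX y hy) hκy).le, fun _ => hX _ (hYX y hy) hκy⟩
  rw [e, Complex.add_re]
  by_cases hx0 : x = 0
  · have hy0 : y ≠ 0 := by
      rintro rfl
      rw [hx0, add_zero, map_zero] at hz0
      exact hz0 rfl
    linarith [Hx.1, Hy.2 hy0]
  · linarith [Hx.2 hx0, Hy.1]

/-! ## The pieces `Z_μ = (V_μ ∩ H^{1,0}) ⊕ (V_{-μ} ∩ H^{0,1})` -/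

section Piece

variable (T : V →ₗ[ℂ] V) (Q : V →ₗ[ℂ] V →ₗ[ℂ] W) (κ : V → V) (β : V ≃ₗ[ℂ] (ι → ℂ))
  {MA GA : Matrix ι ι ℚ} {ω : W}

/-- Isotropy of the eigenspaces (van Geemen 5.2, proof of (4)): if `Q(T x, T y) = 7 Q(x, y)` (Weil type) and
`T x = ν x`, `T y = ν y` with `ν² = -7`, then `Q(x, y) = 0`. [cite: vanGeemen1994HodgeAV, proof of Lemma 5.2 (4)] -/
theorem weilSig_isotropic (hQT : ∀ x y, Q (T x) (T y) = (7 : ℂ) • Q x y) {ν : ℂ} (hν : ν * ν = -7) {x y : V}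
    (hx : T x = ν • x) (hy : T y = ν • y) : Q x y = 0 := by
  have h := hQT x y
  rw [hx, hy, map_smul, map_smul, LinearMap.smul_apply, smul_smul, hν] at h
  have h2 : (14 : ℂ) • Q x y = 0 := by
    have e : (14 : ℂ) • Q x y = (7 : ℂ) • Q x y - (-7 : ℂ) • Q x y := by rw [← sub_smul]; norm_num
    rw [e, h, sub_self]
  rcases smul_eq_zero.1 h2 with h3 | h3
  · norm_num at h3
  · -- unused binders bookkeeping
    exact h3

/-- **Sign of `Re H` on the piece `Z_μ`.** Data as in the module docstring; `μ` with `μ² = -7`, `μ̄ = -μ`,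
`μ · i = m ∈ ℝ`, `m ≠ 0`; Hodge–Riemann: `i Q(x, κ x) = (t ρ) ω` with `t > 0` for `0 ≠ x ∈ H^{1,0}`, `ρ ≠ 0`.
Then `m ρ · Re (z ⬝ C z̄) > 0` for `0 ≠ z ∈ β((V_μ ∩ H^{1,0}) ⊔ (V_{-μ} ∩ H^{0,1}))`: on `x ∈ V_μ ∩ H^{1,0}`,
`(βx ⬝ C \overline{βx}) ω = Q(x, T κx) = -μ Q(x, κ x) = (m t ρ) ω`; `κ` maps `V_{-μ} ∩ H^{0,1}` into
`V_μ ∩ H^{1,0}`; the cross terms vanish by isotropy of `V_{±μ}`; conclude by `weilSig_re_pos_sup` for the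
symmetric matrix `(m ρ) C`. [cite: vanGeemen1994HodgeAV, proof of Lemma 5.2 (4)] -/
theorem weilSig_piece (hω0 : ω ≠ 0) (hsymm : ((GA * MA).map (algebraMap ℚ ℂ)).transpose = (GA * MA).map (algebraMap ℚ ℂ))
    (hQT : ∀ x y, Q (T x) (T y) = (7 : ℂ) • Q x y)
    (hH : ∀ x y, Q x (T (κ y)) = (β x ⬝ᵥ (GA * MA).map (algebraMap ℚ ℂ) *ᵥ star (β y)) • ω)
    (hβκ : ∀ x, β (κ x) = star (β x)) (hTκ : ∀ x, T (κ x) = κ (T x))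
    (hκs : ∀ (c : ℂ) (x : V), κ (c • x) = conj c • κ x)
    {μ : ℂ} (hμ7 : μ * μ = -7) (hμc : conj μ = -μ) {m : ℝ} (hm0 : m ≠ 0) (hμI : μ * Complex.I = (m : ℂ))
    (H10 H01 : Submodule ℂ V) (hκ01 : ∀ x ∈ H01, κ x ∈ H10) {ρ : ℝ} (hρ0 : ρ ≠ 0)
    (hHR : ∀ x ∈ H10, x ≠ 0 → ∃ t : ℝ, 0 < t ∧ Complex.I • Q x (κ x) = ((t : ℂ) * ρ) • ω) :
    ∀ z ∈ ((Module.End.eigenspace T μ ⊓ H10) ⊔ (Module.End.eigenspace T (-μ) ⊓ H01)).map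
        (β : V →ₗ[ℂ] (ι → ℂ)),
      z ≠ 0 → 0 < m * ρ * (z ⬝ᵥ (GA * MA).map (algebraMap ℚ ℂ) *ᵥ star z).re := by
  set C := (GA * MA).map (algebraMap ℚ ℂ) with hC_def
  -- `κ` on eigenvectors
  have hκeig : ∀ {ν : ℂ} {x : V}, T x = ν • x → T (κ x) = conj ν • κ x := fun hx => by
    rw [hTκ, hx, hκs]
  have hneg7 : (-μ) * (-μ) = -7 := by rw [neg_mul_neg, hμ7]
  -- `H(x) = m t ρ` on `V_μ ∩ H^{1,0}`
  have hval : ∀ x ∈ Module.End.eigenspace T μ ⊓ H10, x ≠ 0 →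
      ∃ t : ℝ, 0 < t ∧ β x ⬝ᵥ C *ᵥ star (β x) = ((m * t * ρ : ℝ) : ℂ) := by
    rintro x ⟨hxμ, hx10⟩ hx0
    obtain ⟨t, ht, hHRx⟩ := hHR x hx10 hx0
    refine ⟨t, ht, smul_left_injective ℂ hω0 ?_⟩
    have hTκx : T (κ x) = (-μ) • κ x := by rw [hκeig (Module.End.mem_eigenspace_iff.1 hxμ), hμc]
    have e1 : Q x (κ x) = (-Complex.I * ((t : ℂ) * ρ)) • ω := by
      have e2 : Q x (κ x) = (-Complex.I) • (Complex.I • Q x (κ x)) := by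
        rw [smul_smul, show -Complex.I * Complex.I = 1 by rw [neg_mul, Complex.I_mul_I, neg_neg], one_smul]
      rw [e2, hHRx, smul_smul]
    change (β x ⬝ᵥ C *ᵥ star (β x)) • ω = _
    rw [← hH, hTκx, map_smul, e1, smul_smul]
    congr 1
    push_cast
    linear_combination ((t : ℂ) * ρ) * hμI
  -- the scaled symmetric matrix
  set C' : Matrix ι ι ℂ := ((m * ρ : ℝ) : ℂ) • C with hC'_def
  have hC' : C'.transpose = C' := by rw [hC'_def, Matrix.transpose_smul, hsymm]
  have hC'app : ∀ a c : ι → ℂ, a ⬝ᵥ C' *ᵥ c = ((m * ρ : ℝ) : ℂ) * (a ⬝ᵥ C *ᵥ c) := fun a c => by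
    rw [hC'_def, Matrix.smul_mulVec, dotProduct_smul, smul_eq_mul]
  have key := weilSig_re_pos_sup β κ hβκ C' hC' (Module.End.eigenspace T μ ⊓ H10)
    (Module.End.eigenspace T (-μ) ⊓ H01) ?_ ?_ ?_ ?_
  · intro z hz hz0
    have h := key z hz hz0
    rwa [hC'app, Complex.re_ofReal_mul] at h
  · -- `H > 0` on `X`
    intro x hx hx0
    obtain ⟨t, ht, hv⟩ := hval x hx hx0
    rw [hC'app, hv, ← Complex.ofReal_mul, Complex.ofReal_re,
      show m * ρ * (m * t * ρ) = m * m * (ρ * ρ) * t by ring]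
    exact mul_pos (mul_pos (mul_self_pos.2 hm0) (mul_self_pos.2 hρ0)) ht
  · -- `κ Y ⊆ X`
    rintro y ⟨hyμ, hy01⟩
    refine ⟨Module.End.mem_eigenspace_iff.2 ?_, hκ01 y hy01⟩
    rw [hκeig (Module.End.mem_eigenspace_iff.1 hyμ), map_neg, hμc, neg_neg]
  · -- `X ⊥ Y`
    rintro x ⟨hxμ, -⟩ y ⟨hyμ, -⟩
    rw [hC'app]
    refine mul_eq_zero_of_right _ (smul_left_injective ℂ hω0 ?_)
    change (β x ⬝ᵥ C *ᵥ star (β y)) • ω = (0 : ℂ) • ω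
    have hTκy : T (κ y) = μ • κ y := by
      rw [hκeig (Module.End.mem_eigenspace_iff.1 hyμ), map_neg, hμc, neg_neg]
    rw [← hH, hTκy, map_smul, weilSig_isotropic T Q hQT hμ7 (Module.End.mem_eigenspace_iff.1 hxμ) hTκy,
      smul_zero, zero_smul]
  · -- `Y ⊥ X`
    rintro x ⟨hxμ, -⟩ y ⟨hyμ, -⟩
    rw [hC'app]
    refine mul_eq_zero_of_right _ (smul_left_injective ℂ hω0 ?_)
    change (β y ⬝ᵥ C *ᵥ star (β x)) • ω = (0 : ℂ) • ω
    have hTκx : T (κ x) = (-μ) • κ x := by rw [hκeig (Module.End.mem_eigenspace_iff.1 hxμ), hμc]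
    rw [← hH, hTκx, map_smul, weilSig_isotropic T Q hQT hneg7 (Module.End.mem_eigenspace_iff.1 hyμ) hTκx,
      smul_zero, zero_smul]

omit [Fintype ι] in
/-- **`dim Z_μ ≥ 2n`**: `κ` maps `V_μ ∩ H^{1,0}` (dimension `n`) into `V_{-μ} ∩ H^{0,1}`, conjugate-linearly and
injectively, and `V_μ ∩ V_{-μ} = 0` (`μ ≠ 0`). [cite: vanGeemen1994HodgeAV, proof of Lemma 5.2 (4)] -/
theorem weilSig_piece_finrank [Module.Finite ℂ V] (hβκ : ∀ x, β (κ x) = star (β x))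
    (hTκ : ∀ x, T (κ x) = κ (T x)) (hκs : ∀ (c : ℂ) (x : V), κ (c • x) = conj c • κ x)
    {μ : ℂ} (hμ0 : μ ≠ 0) (hμc : conj μ = -μ) (H10 H01 : Submodule ℂ V) (hκ10 : ∀ x ∈ H10, κ x ∈ H01)
    {n : ℕ} (hn : Module.finrank ℂ ↥(Module.End.eigenspace T μ ⊓ H10) = n) :
    2 * n ≤ Module.finrank ℂ ↥(((Module.End.eigenspace T μ ⊓ H10) ⊔ (Module.End.eigenspace T (-μ) ⊓ H01)).map
      (β : V →ₗ[ℂ] (ι → ℂ))) := by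
  have hκa : ∀ x y, κ (x + y) = κ x + κ y := fun x y =>
    β.injective (by rw [hβκ, map_add, map_add, star_add, hβκ, hβκ])
  have hκκ : ∀ x, κ (κ x) = x := fun x => β.injective (by rw [hβκ, hβκ, star_star])
  set X := Module.End.eigenspace T μ ⊓ H10
  set Y := Module.End.eigenspace T (-μ) ⊓ H01
  have hXY : ∀ x ∈ X, κ x ∈ Y := by
    rintro x ⟨hxμ, hx10⟩
    refine ⟨Module.End.mem_eigenspace_iff.2 ?_, hκ10 x hx10⟩
    rw [hTκ, Module.End.mem_eigenspace_iff.1 hxμ, hκs, hμc]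
  have hY : n ≤ Module.finrank ℂ Y := hn ▸ weilSig_finrank_le_of_semilinear κ hκa hκs hκκ X Y hXY
  have hdis : X ⊓ Y = ⊥ := by
    rw [Submodule.eq_bot_iff]
    rintro x ⟨⟨hxμ, -⟩, ⟨hxμ', -⟩⟩
    have h1 := Module.End.mem_eigenspace_iff.1 hxμ
    have h2 := Module.End.mem_eigenspace_iff.1 hxμ'
    rw [h1, neg_smul] at h2
    have h3 : ((2 : ℂ) * μ) • x = 0 := by
      rw [mul_smul, two_smul]
      nth_rewrite 1 [h2]
      rw [neg_add_cancel]
    rcases smul_eq_zero.1 h3 with h | h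
    · exact absurd h (mul_ne_zero two_ne_zero hμ0)
    · exact h
  rw [LinearEquiv.finrank_map_eq]
  have h := Submodule.finrank_sup_add_finrank_inf_eq X Y
  rw [hdis, finrank_bot, add_zero, hn] at h
  omega

end Piece

/-! ## Both pieces: `Z₊` and `Z₋` -/

/-- **The two definite pieces of `H¹`** (van Geemen 1994, proof of Lemma 5.2 (4): `H` has signature `(n, n)`,
being definite of opposite signs on `Z₁ = V₊^{1,0} ⊕ V₋^{0,1}` and `Z₂ = V₋^{1,0} ⊕ V₊^{0,1}`, each of dimension
`2n`). With `s = m i`, `m > 0`, `m² = 7` (so `s = i√7`), `T = φ^*` with rational matrix `M_A`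
(`β (T x) = M_A βx`), `Q` with rational Gram matrix `G_A` (`Q x y = (βx ⬝ G_A βy) ω`, `ω ≠ 0`), `M_A² = -7`,
`G_A` alternating of Weil type, `κ` a coordinatewise conjugation commuting with `T`, Hodge pieces `H^{1,0}`,
`H^{0,1}` swapped by `κ`, multiplicities `dim (V_{±s} ∩ H^{1,0}) = n`, and Hodge–Riemann in the form
`i Q(x, κ x) = (t ρ) ω`, `t > 0`, on `H^{1,0} ∖ 0` for a fixed real `ρ ≠ 0`: there are complex subspaces
`Z₊`, `Z₋ ⊆ ℂ^ι` of dimension `≥ 2n` with `Re (z ⬝ G_A M_A z̄) > 0` on `Z₊ ∖ 0` and `< 0` on `Z₋ ∖ 0`.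
[cite: vanGeemen1994HodgeAV, Lemma 5.2 (4)] -/
theorem weilSig_exists_Zp_Zn {ι : Type*} [Fintype ι] [DecidableEq ι] {V W : Type*} [AddCommGroup V]
    [Module ℂ V] [Module.Finite ℂ V] [AddCommGroup W] [Module ℂ W] (T : V →ₗ[ℂ] V)
    (Q : V →ₗ[ℂ] V →ₗ[ℂ] W) (κ : V → V) (β : V ≃ₗ[ℂ] (ι → ℂ)) {MA GA : Matrix ι ι ℚ} {ω : W}
    (hω0 : ω ≠ 0) (hMA : MA * MA = (-7 : ℚ) • (1 : Matrix ι ι ℚ)) (hGA : GA.transpose = -GA)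
    (hWt : MA.transpose * GA * MA = (7 : ℚ) • GA)
    (hβT : ∀ x, β (T x) = (MA.map (algebraMap ℚ ℂ)).mulVec (β x))
    (hβQ : ∀ x y, Q x y = (β x ⬝ᵥ (GA.map (algebraMap ℚ ℂ)).mulVec (β y)) • ω)
    (hβκ : ∀ x, β (κ x) = star (β x)) (hTκ : ∀ x, T (κ x) = κ (T x))
    (hκs : ∀ (c : ℂ) (x : V), κ (c • x) = (starRingEnd ℂ) c • κ x)
    {m : ℝ} (hm : 0 < m) (hm7 : m * m = 7) {s : ℂ} (hs : s = (m : ℂ) * Complex.I)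
    (H10 H01 : Submodule ℂ V) (hκ01 : ∀ x ∈ H01, κ x ∈ H10) (hκ10 : ∀ x ∈ H10, κ x ∈ H01) {n : ℕ}
    (hVp : Module.finrank ℂ ↥(Module.End.eigenspace T s ⊓ H10) = n)
    (hVm : Module.finrank ℂ ↥(Module.End.eigenspace T (-s) ⊓ H10) = n) {ρ : ℝ} (hρ0 : ρ ≠ 0)
    (hHR : ∀ x ∈ H10, x ≠ 0 → ∃ t : ℝ, 0 < t ∧ Complex.I • Q x (κ x) = ((t : ℂ) * ρ) • ω) :
    ∃ Zp Zn : Submodule ℂ (ι → ℂ), 2 * n ≤ Module.finrank ℂ Zp ∧ 2 * n ≤ Module.finrank ℂ Zn ∧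
      (∀ z ∈ Zp, z ≠ 0 → 0 < (z ⬝ᵥ ((GA * MA).map (algebraMap ℚ ℂ)).mulVec (star z)).re) ∧
      (∀ z ∈ Zn, z ≠ 0 → (z ⬝ᵥ ((GA * MA).map (algebraMap ℚ ℂ)).mulVec (star z)).re < 0) := by
  -- arithmetic of `s`
  have hII : Complex.I * Complex.I = -1 := Complex.I_mul_I
  have hmm : (m : ℂ) * (m : ℂ) = 7 := by exact_mod_cast hm7
  have hs7 : s * s = -7 := by
    rw [hs]
    linear_combination ((m : ℂ) * (m : ℂ)) * hII - hmm
  have hsc : (starRingEnd ℂ) s = -s := by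
    rw [hs, map_mul, Complex.conj_ofReal, Complex.conj_I]
    ring
  have hnsc : (starRingEnd ℂ) (-s) = -(-s) := by rw [map_neg, hsc]
  have hns7 : (-s) * (-s) = -7 := by rw [neg_mul_neg, hs7]
  have hsI : s * Complex.I = ((-m : ℝ) : ℂ) := by
    rw [hs]
    push_cast
    linear_combination (m : ℂ) * hII
  have hnsI : (-s) * Complex.I = (m : ℂ) := by
    rw [neg_mul, hsI]
    push_cast
    ring
  have hs0 : s ≠ 0 := by
    rw [hs]
    exact mul_ne_zero (by exact_mod_cast hm.ne') Complex.I_ne_zero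
  -- matrix identities over `ℂ`
  set C := (GA * MA).map (algebraMap ℚ ℂ) with hC_def
  have hsymm : C.transpose = C := by
    -- `(G M)ᵀ = Mᵀ Gᵀ = -Mᵀ G = G M` (from `Mᵀ G M M = 7 G M`, `M M = -7`)
    have h1 : MA.transpose * GA = -(GA * MA) := by
      have h : MA.transpose * GA * MA * MA = (7 : ℚ) • (GA * MA) := by rw [hWt, Matrix.smul_mul]
      rw [Matrix.mul_assoc, hMA, Matrix.mul_smul, Matrix.mul_one] at h
      have h2 : (7 : ℚ) • (MA.transpose * GA + GA * MA) = 0 := by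
        rw [smul_add, ← h, neg_smul, add_neg_cancel]
      rcases smul_eq_zero.1 h2 with h3 | h3
      · norm_num at h3
      · exact eq_neg_of_add_eq_zero_left h3
    have h2 : (GA * MA).transpose = GA * MA := by
      rw [Matrix.transpose_mul, hGA, Matrix.mul_neg, h1, neg_neg]
    rw [hC_def, ← Matrix.transpose_map, h2]
  have hQT : ∀ x y, Q (T x) (T y) = (7 : ℂ) • Q x y := by
    intro x y
    rw [hβQ, hβQ x y, hβT, hβT, smul_smul]
    congr 1
    have h := Matrix.toBilin'_comp (GA.map (algebraMap ℚ ℂ)) (MA.map (algebraMap ℚ ℂ)) (MA.map (algebraMap ℚ ℂ))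
    rw [← Matrix.transpose_map, ← Matrix.map_mul, ← Matrix.map_mul, hWt] at h
    have h' := congrArg (fun B : LinearMap.BilinForm ℂ (ι → ℂ) => B (β x) (β y)) h
    simp only [LinearMap.BilinForm.comp_apply, Matrix.toLin'_apply, Matrix.toBilin'_apply'] at h'
    rw [h']
    have e : ((7 : ℚ) • GA).map (algebraMap ℚ ℂ) = (7 : ℂ) • GA.map (algebraMap ℚ ℂ) := by
      ext i j
      simp
    rw [e, Matrix.smul_mulVec, dotProduct_smul, smul_eq_mul]
  have hH : ∀ x y, Q x (T (κ y)) = (β x ⬝ᵥ C *ᵥ star (β y)) • ω := by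
    intro x y
    rw [hβQ, hβT, hβκ, Matrix.mulVec_mulVec, ← Matrix.map_mul]
  -- the two pieces
  have hP1 := weilSig_piece T Q κ β hω0 hsymm hQT hH hβκ hTκ hκs hs7 hsc (neg_ne_zero.2 hm.ne') hsI H10 H01
    hκ01 hρ0 hHR
  have hP2 := weilSig_piece T Q κ β hω0 hsymm hQT hH hβκ hTκ hκs hns7 hnsc hm.ne' hnsI H10 H01 hκ01 hρ0 hHR
  have hF1 := weilSig_piece_finrank T κ β hβκ hTκ hκs hs0 hsc H10 H01 hκ10 hVp
  have hF2 := weilSig_piece_finrank T κ β hβκ hTκ hκs (neg_ne_zero.2 hs0) hnsc H10 H01 hκ10 hVm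
  rw [neg_neg] at hP2 hF2
  set Z1 := ((Module.End.eigenspace T s ⊓ H10) ⊔ (Module.End.eigenspace T (-s) ⊓ H01)).map
    (β : V →ₗ[ℂ] (ι → ℂ))
  set Z2 := ((Module.End.eigenspace T (-s) ⊓ H10) ⊔ (Module.End.eigenspace T s ⊓ H01)).map
    (β : V →ₗ[ℂ] (ι → ℂ))
  -- sign bookkeeping: `0 < a r` gives `r` the sign of `a`
  have sgn : ∀ {a r : ℝ}, 0 < a * r → (0 < a → 0 < r) ∧ (a < 0 → r < 0) := fun {a r} h => by
    rcases pos_and_pos_or_neg_and_neg_of_mul_pos h with ⟨ha, hr⟩ | ⟨ha, hr⟩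
    · exact ⟨fun _ => hr, fun ha' => absurd ha (not_lt.2 ha'.le)⟩
    · exact ⟨fun ha' => absurd ha' (not_lt.2 ha.le), fun _ => hr⟩
  rcases lt_or_gt_of_ne hρ0 with hρ | hρ
  · -- `ρ < 0`: `Z₊ = Z₁`, `Z₋ = Z₂`
    refine ⟨Z1, Z2, hF1, hF2, fun z hz hz0 => (sgn (hP1 z hz hz0)).1 (by nlinarith),
      fun z hz hz0 => (sgn (hP2 z hz hz0)).2 (by nlinarith)⟩
  · -- `ρ > 0`: `Z₊ = Z₂`, `Z₋ = Z₁`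
    refine ⟨Z2, Z1, hF2, hF1, fun z hz hz0 => (sgn (hP2 z hz hz0)).1 (by nlinarith),
      fun z hz hz0 => (sgn (hP1 z hz hz0)).2 (by nlinarith)⟩

end Summit.HodgeConjecture.HodgeConjecture.Theorems.WeilTwelvefoldsSqrtMinus7.AmnesicSecantSheaves

end
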